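import Summits.QuantumFields.YangMills.Theorems.FlatTubeReductionFPWeightSharp
import Summits.QuantumFields.YangMills.Theorems.LuscherReductionTwistedTraceScalingFPWeightCoreAt
import HarnessLib

/-!
# The Faddeev–Popov weight POINTWISE: on the fat tube, `N(U)/N̄(s)` is `1` up to `K_D(2+32K)²·τ_U²` (τ_U = the link deviation of `U` ITSELF, not the tube radius), a core-radius term
# `∝ r` (free, `r ≤ t²`), the Gaussian tails at radius `r`, and `O(s²)` — the deterministic statement of F9c ((N) POINTWISE AT RATE)
# (route `FlatTubeReduction`, crux K1 `NearFlatRatioLaw` stmt-QuantumFields-24720; seat `ym-line-ftr-p1` g14; rate twin «ratepack-v3 / frozen fibres»; R2b1 RECORD rung — no summit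
# statement is proved here; template = RED lane A's `…FPWeightCoreAt.fpWeight_core_at` for crux 20203)

WHY (memo `Cruxes/NearFlatRatioLaw/Lines/ratepack-v3-frozen-g12.md` §8.1).  Lane A's `fpWeight_core_at` proves `N(U) = N̄(1 ± Ct²)` UNIFORMLY on the fat tube of radius `t = δ β`, with
three error sources all set to `t²`: the gramDet ratio (`K‖p‖²`, `‖p‖ ≤ (2+32K)t` from the orbit minimiser), the Gaussian core radius `r = t²`, and (lower bound only) the support-radius density
loss `6nR₁²`.  For the rate twin's normalised dressing the deviation must be `∝ τ_U²` POINTWISE, `τ_U` = link deviation of `U` (for `U = oT u v`: `O(orbitDist u + ‖v̂‖)`), plus `O(λ_b²)`.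
Here: (i) the slice representative is built from `U` directly (links within `τ ≤ t`), so `‖p‖ ≤ (2+32K)τ`; (ii) the core radius `r ≤ t²` is FREE (the caller takes `r = s·√log`) and its
tail `2^{d/2}e^{−c²r²/2s²} ≤ 1/4` is a hypothesis, the tail terms staying explicit in the output; (iii) the density loss is gone (`fpWeight_relative_bounds_sharp`, p707524), replaced by
`96n·C_L²·s²` inside `η′`.
  ★★★ `fpWeight_pointwise_at` — `N̄(s)·(1 − (d/2)(12C_L(M_T+2B)r + 96nC_L²s²) − 2^{d/2}e^{−c²r²/2s²})·(1 − K_D(2+32K)²τ²) ≤ N(U) ≤ N̄(s)·(1 + 4(d/2)·12C_L(M_T+2B)r + 4^{d/2}e^{−c²r²/4s²})·(1 + K_D(2+32K)²τ²)`.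
HONEST FRAMING: bookkeeping on lane A's landed (N2) tool-chain; the eventually-in-β instance at `U = oT u v` (F9d) and the mass ratio (F9e) remain; femto rung R2b1 (RECORD label); not infinite
volume, not a gap, not Clay.  No defs, no named facts, no `sorry`.
-/

set_option autoImplicit false

noncomputable section

open MeasureTheory Real Module
open scoped BigOperators
open Literature.MathematicalPhysics.QuantumFieldTheory
open Literature.MathematicalPhysics.QuantumLattice

namespace Summit.QuantumFields.YangMills.Theorems.FemtoTransferGap.TwoLattice.ConstTube

open Summit.QuantumFields.YangMills.Theorems.FemtoTransferGap
open Summit.QuantumFields.YangMills.Theorems.FemtoTransferGap.TwoLattice.Avg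
open Summit.QuantumFields.YangMills.Theorems.FemtoTransferGap.TwoLattice.Stiff (LinkSpace)

variable (L : ℕ) [NeZero L]

set_option maxHeartbeats 1600000 in
/-- ★★★ **THE FP WEIGHT POINTWISE ON THE FAT TUBE.**  Constants and the tube-scale smallness `h1`–`h13`, `h16` exactly as in `fpWeight_core_at` (`t = δ β`, `ρ β = Mt`, `0 < s = δg β`);
`h13` strengthened to `≤ 1/8`; in addition a LINK deviation `0 < τ ≤ t` of `U` (`‖U_e − 1‖_F ≤ τ`), a free core radius `0 ≤ r ≤ t²` with its tail hypothesis `2^{d/2}e^{−c²r²/(2s²)} ≤ 1/4`, and the `s²`-smallness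
`(d/2 + 1)·96nC_L²s² ≤ 1/8`.  Then
`N̄(s)(1 − (d/2)(12C_L(M_T+2B)r + 96nC_L²s²) − 2^{d/2}e^{−c²r²/(2s²)})(1 − K_D(2+32K)²τ²) ≤ N(U) ≤ N̄(s)(1 + 4(d/2)12C_L(M_T+2B)r + 4^{d/2}e^{−c²r²/(4s²)})(1 + K_D(2+32K)²τ²)`.
[cite: Luscher1983, §3] -/
theorem fpWeight_pointwise_at (hL : Nonempty (NzSite L))
    {K ε : ℝ} (hK : 0 ≤ K)
    (hSP : ∀ w : Edge 3 L → Fin 3 → ℝ, w ∈ balancedSet L → ∀ c : Fin 3 → Fin 3 → ℝ, ‖w‖ < ε → ‖c‖ < ε →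
      ∃ ξ : Site 3 L → Fin 3 → ℝ, ∑ x : Site 3 L, ξ x = 0 ∧ ‖ξ‖ ≤ K * ‖w‖ ∧
        gaugeCoordSq L (gaugeTransform (fun x => chartSU2 (ξ x)) (orthoTube L (fun e₁ => chartSU2 (c e₁.2)) w)) = 0)
    {M_T ε_T : ℝ} (hMT : 0 ≤ M_T) (hεT : 0 < ε_T)
    (hT : ∀ (ξ : basedSubmodule L) (q : balancedSubmodule L × (Fin 3 → Fin 3 → ℝ)), ‖ξ‖ < ε_T → ‖q‖ < ε_T →
      ‖basedFn L (ξ, q) - basedFn L (0, q) - basedLin L q ξ‖ ≤ M_T * ‖ξ‖ ^ 2)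
    {ε_C : ℝ} (hC : ∀ q : balancedSubmodule L × (Fin 3 → Fin 3 → ℝ), ‖q‖ < ε_C →
      ∀ ξ : basedSubmodule L, ‖ξ‖ ≤ 4 * sliceConst L * ‖(gaugeModes L).starProjection (basedLin L q ξ)‖)
    {ε_I : ℝ} (hI : ∀ q : balancedSubmodule L × (Fin 3 → Fin 3 → ℝ), ‖q‖ < ε_I → ∀ {a s : ℝ}, 0 < a → 0 < s →
      ∫ w, Real.exp (-(a * ‖laplaceMap L q w‖ ^ 2 / s ^ 2)) ∂(volume : Measure (NzSite L → Fin 3 → ℝ)) =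
        (π * s ^ 2 / a) ^ (finrank ℝ (EuclideanSpace ℝ (NzSite L × Fin 3)) / 2 : ℝ) / Real.sqrt (gramDet L q))
    {K_D ε_D : ℝ} (hKD : 0 ≤ K_D) (hD : ∀ q : balancedSubmodule L × (Fin 3 → Fin 3 → ℝ), ‖q‖ < ε_D → |gramDet L q / gramDet L 0 - 1| ≤ K_D * ‖q‖ ^ 2)
    {B ε_B : ℝ} (hB0 : 0 ≤ B) (hB : ∀ q : balancedSubmodule L × (Fin 3 → Fin 3 → ℝ), ‖q‖ < ε_B → ‖basedLin L q‖ ≤ B)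
    {δ ρ δg : ℝ → ℝ} {β M : ℝ} (hM : 3 + 16 * K ≤ M) (hρ : ρ β = M * δ β) (ht0 : 0 < δ β) (hs0 : 0 < δg β)
    -- smallness of `t = δ β` (as in `fpWeight_core_at`)
    (h1 : δ β ≤ 1 / 8) (h2 : δ β ≤ ε / 4) (h3 : 2 * K * δ β ≤ 1 / 2) (h4 : (1 + 16 * K) * δ β ≤ 1 / 4)
    (h5 : (2 + 32 * K) * δ β < ε_T) (h6 : (2 + 32 * K) * δ β < ε_C) (h7 : (2 + 32 * K) * δ β < ε_I) (h8 : (2 + 32 * K) * δ β < ε_D)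
    (h9 : (2 + 32 * K) * δ β < ε_B) (h10 : (2 + 32 * K) * δ β ≤ 1 / 40)
    (h11 : (3 * ((L : ℝ) - 1) * (2 + 16 * K + M) + 1) * δ β < ε_T)
    (h12 : 4 * sliceConst L * (M_T + 2 * B) * (3 * ((L : ℝ) - 1) * (2 + 16 * K + M) + 1) * δ β ≤ 1 / 4)
    (h13 : (flatDim L / 2 + 1 : ℝ) * (12 * sliceConst L * (M_T + 2 * B)) * δ β ≤ 1 / 8)
    (h15 : 6 * (Fintype.card (NzSite L) : ℝ) * (3 * ((L : ℝ) - 1) * (2 + 16 * K + M) + 1) ^ 2 * δ β ≤ 1)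
    (h16 : K_D * (2 + 32 * K) ^ 2 * δ β ≤ 1 / 2)
    -- the pointwise data: link deviation `τ`, core radius `r`, its tail, and the `s²`-smallness
    {τ : ℝ} (hτ0 : 0 < τ) (hτt : τ ≤ δ β) {r : ℝ} (hr0 : 0 ≤ r) (hrt : r ≤ δ β ^ 2)
    (htl : (2 : ℝ) ^ (flatDim L / 2 : ℝ) * Real.exp (-((1 / (4 * sliceConst L)) ^ 2 * r ^ 2 / (2 * δg β ^ 2))) ≤ 1 / 4)
    (h17 : (flatDim L / 2 + 1 : ℝ) * (96 * Fintype.card (NzSite L) * sliceConst L ^ 2 * δg β ^ 2) ≤ 1 / 8)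
    {U : GaugeConfig 3 L SU2} (hU : U ∈ fatTubeRho L δ ρ β) (hUτ : ∀ e : Edge 3 L, frobNorm (((U e : SU2) : Matrix (Fin 2) (Fin 2) ℂ) - 1) ≤ τ) :
    fpWeightBar L (δg β) * ((1 - (flatDim L / 2 : ℝ) * (12 * sliceConst L * (M_T + 2 * B) * r + 96 * Fintype.card (NzSite L) * sliceConst L ^ 2 * δg β ^ 2) -
        (2 : ℝ) ^ (flatDim L / 2 : ℝ) * Real.exp (-((1 / (4 * sliceConst L)) ^ 2 * r ^ 2 / (2 * δg β ^ 2)))) * (1 - K_D * (2 + 32 * K) ^ 2 * τ ^ 2)) ≤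
        gaugeAvg (recordWeightRho L δ ρ δg β) U ∧
      gaugeAvg (recordWeightRho L δ ρ δg β) U ≤ fpWeightBar L (δg β) *
        ((1 + 4 * (flatDim L / 2 : ℝ) * (12 * sliceConst L * (M_T + 2 * B) * r) + (4 : ℝ) ^ (flatDim L / 2 : ℝ) * Real.exp (-((1 / (4 * sliceConst L)) ^ 2 * r ^ 2 / (4 * δg β ^ 2)))) *
          (1 + K_D * (2 + 32 * K) ^ 2 * τ ^ 2)) := by
  set t : ℝ := δ β with htdef
  have hCpos := sliceConst_pos L
  have ht1 : t ≤ 1 := by linarith only [h1]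
  have htt : t ^ 2 ≤ t := by nlinarith only [ht0, ht1]
  have hL1 : (1 : ℝ) ≤ (L : ℝ) := by exact_mod_cast NeZero.one_le
  have hτ1 : τ ≤ 1 := hτt.trans ht1
  -- STEP 1: the links of `U` itself are within `τ`
  have hUsc : ∀ e : Edge 3 L, 1 - (τ / 2) ^ 2 ≤ scalarPart (U e) := fun e => by
    have := scalarPart_ge_of_frobNorm_le (hUτ e); rw [show (τ / 2) ^ 2 = τ ^ 2 / 4 by ring]; exact this
  have hUorb : orbitDist U < t := hU.2
  -- STEP 2: the slice representative (smallness at `τ ≤ t`)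
  have h1τ : τ ≤ 1 / 8 := hτt.trans h1
  have h2τ : τ ≤ ε / 4 := hτt.trans h2
  have h3τ : 2 * K * τ ≤ 1 / 2 := (mul_le_mul_of_nonneg_left hτt (by positivity)).trans h3
  have h4τ : (1 + 16 * K) * τ ≤ 1 / 4 := (mul_le_mul_of_nonneg_left hτt (by positivity)).trans h4
  obtain ⟨hτ50, hτε1, hτε2, hτK, hτ', hRle⟩ := slice_smallness hK hτ0 h1τ h2τ h3τ h4τ
  obtain ⟨ξ, p, htube, hslice, hsc, -, hpn⟩ := exists_slice_tubePt L hK hSP (sq_nonneg (τ / 2)) hτ50 hτε1 hτε2 hτK hτ' hUsc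
  set R : ℝ := 2 * Real.sqrt ((τ / 2) ^ 2) + 8 * (K * Real.sqrt (10 * (τ / 2) ^ 2)) with hRdef
  have hR0 : 0 ≤ R := by rw [hRdef]; positivity
  have hP0 : 0 ≤ (2 + 32 * K) * τ := by positivity
  have hp : ‖p‖ ≤ (2 + 32 * K) * τ := (hpn.trans (norm_bound_of_rep hR0)).trans (by linarith only [hRle])
  have hpt : ‖p‖ ≤ (2 + 32 * K) * t := hp.trans (mul_le_mul_of_nonneg_left hτt (by positivity))
  have hpT : ‖p‖ < ε_T := lt_of_le_of_lt hpt h5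
  have hpC : ‖p‖ < ε_C := lt_of_le_of_lt hpt h6
  have hpI : ∀ {a s' : ℝ}, 0 < a → 0 < s' → ∫ w, Real.exp (-(a * ‖laplaceMap L p w‖ ^ 2 / s' ^ 2)) ∂(volume : Measure (NzSite L → Fin 3 → ℝ)) =
      (π * s' ^ 2 / a) ^ (finrank ℝ (EuclideanSpace ℝ (NzSite L × Fin 3)) / 2 : ℝ) / Real.sqrt (gramDet L p) :=
    fun ha hs' => hI p (lt_of_le_of_lt hpt h7) ha hs'
  have hpD := hD p (lt_of_le_of_lt hpt h8)
  have hpB := hB p (lt_of_le_of_lt hpt h9)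
  have hp40 : ‖p‖ ≤ 1 / 40 := hpt.trans h10
  -- links of the representative and its fat-tube membership (at the tube scale `t`)
  set ρ₁ : ℝ := (2 + 16 * K) * t with hρ₁def
  have hlinks : ∀ e : Edge 3 L, frobNorm (((tubePt L p e : SU2) : Matrix (Fin 2) (Fin 2) ℂ) - 1) < ρ₁ := fun e => by
    have h := frobNorm_le_of_scalarPart_ge' hR0 (hsc e)
    have hRτ : R ≤ (1 + 16 * K) * τ := hRle
    have : R < ρ₁ := by
      rw [hρ₁def]
      have := mul_le_mul_of_nonneg_left hτt (by positivity : (0 : ℝ) ≤ 1 + 16 * K)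
      nlinarith only [hRτ, this, ht0]
    exact lt_of_le_of_lt h this
  obtain ⟨hNrep, hOrep⟩ := gaugeAvg_tubePt_rep L (δ := δ) (ρ := ρ) (δg := δg) (β := β) htube
  have hUfat : tubePt L p ∈ fatTubeRho L δ (fun _ => ρ₁) β := by
    refine ⟨fun e => hlinks e, ?_⟩
    show orbitDist (tubePt L p) < δ β
    rw [hOrep]; exact hUorb
  have hNU : gaugeAvg (recordWeightRho L δ ρ δg β) U = gaugeAvg (recordWeightRho L δ ρ δg β) (tubePt L p) := hNrep.symm
  -- STEP 3: radii and the hypotheses of the sharp relative bounds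
  set Q : ℝ := 3 * ((L : ℝ) - 1) * (2 + 16 * K + M) + 1 with hQdef
  have hM0 : 0 ≤ M := by linarith only [hM, hK]
  have hX0 : 0 ≤ 3 * ((L : ℝ) - 1) * (2 + 16 * K + M) := mul_nonneg (mul_nonneg (by norm_num) (sub_nonneg.mpr hL1)) (by linarith only [hK, hM0])
  have hQ1 : 1 ≤ Q := by rw [hQdef]; linarith only [hX0]
  have hQ0 : 0 ≤ Q := by linarith only [hQ1]
  set R₁ : ℝ := 3 * ((L : ℝ) - 1) * (ρ₁ + ρ β) + t ^ 2 with hR₁def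
  have hR₁Q : R₁ ≤ Q * t := by
    rw [hR₁def, hQdef, hρ₁def, hρ]
    have : 3 * ((L : ℝ) - 1) * ((2 + 16 * K) * t + M * t) = 3 * ((L : ℝ) - 1) * (2 + 16 * K + M) * t := by ring
    rw [this]; linarith only [htt]
  have hR₁0 : 0 ≤ 3 * ((L : ℝ) - 1) * (ρ₁ + ρ β) := by
    rw [hρ, hρ₁def]; exact mul_nonneg (mul_nonneg (by norm_num) (sub_nonneg.mpr hL1)) (by positivity)
  have hrR : r ≤ R₁ := by rw [hR₁def]; linarith only [hR₁0, hrt]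
  have hR1T : R₁ < ε_T := lt_of_le_of_lt hR₁Q h11
  have hn1 : (1 : ℝ) ≤ (Fintype.card (NzSite L) : ℝ) := by exact_mod_cast Fintype.card_pos
  have hR1half : R₁ ≤ 1 / 2 := by
    have e1 : 1 * (Q * t) ≤ Q * (Q * t) := mul_le_mul_of_nonneg_right hQ1 (mul_nonneg hQ0 ht0.le)
    have e2 : Q ^ 2 * t ≤ (Fintype.card (NzSite L) : ℝ) * (Q ^ 2 * t) := le_mul_of_one_le_left (by positivity) hn1
    have e3 : Q * (Q * t) = Q ^ 2 * t := by ring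
    have e4 : (Fintype.card (NzSite L) : ℝ) * (Q ^ 2 * t) = (Fintype.card (NzSite L) : ℝ) * Q ^ 2 * t := by ring
    linarith only [e1, e2, e3, e4, h15, hR₁Q]
  have hcore : ρ₁ + 8 * r ≤ ρ β := by rw [hρ, hρ₁def]; nlinarith only [hM, h1, ht0, hrt]
  have hsupp : 3 * ((L : ℝ) - 1) * (ρ₁ + ρ β) ≤ R₁ := by rw [hR₁def]; linarith only [sq_nonneg t]
  have hBp : M_T + 2 * ‖basedLin L p‖ ≤ M_T + 2 * B := by linarith only [hpB]
  have hθ : (M_T + 2 * ‖basedLin L p‖) * R₁ * (4 * sliceConst L) ≤ 1 / 4 := by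
    have hR₁0' : 0 ≤ R₁ := le_trans hr0 hrR
    calc (M_T + 2 * ‖basedLin L p‖) * R₁ * (4 * sliceConst L) ≤ (M_T + 2 * B) * (Q * t) * (4 * sliceConst L) := by gcongr
      _ = 4 * sliceConst L * (M_T + 2 * B) * Q * t := by ring
      _ ≤ 1 / 4 := h12
  -- `η ≤ 12 C_L (M_T + 2B)·r ≤ 12 C_L (M_T+2B)·t`
  have hηle : fpEta L M_T p r ≤ 12 * sliceConst L * (M_T + 2 * B) * r := by
    unfold fpEta
    calc 3 * ((M_T + 2 * ‖basedLin L p‖) * r * (4 * sliceConst L)) ≤ 3 * ((M_T + 2 * B) * r * (4 * sliceConst L)) := by gcongr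
      _ = 12 * sliceConst L * (M_T + 2 * B) * r := by ring
  have hA2_0 : 0 ≤ 12 * sliceConst L * (M_T + 2 * B) := by positivity
  have hd0 : (0 : ℝ) ≤ (flatDim L / 2 : ℝ) := by positivity
  have hrt' : r ≤ t := hrt.trans htt
  have hAr : 12 * sliceConst L * (M_T + 2 * B) * r ≤ 12 * sliceConst L * (M_T + 2 * B) * t := mul_le_mul_of_nonneg_left hrt' hA2_0
  have hAt0 : 0 ≤ 12 * sliceConst L * (M_T + 2 * B) * t := mul_nonneg hA2_0 ht0.le
  have eA2 : 12 * sliceConst L * (M_T + 2 * B) * t ≤ (flatDim L / 2 + 1 : ℝ) * (12 * sliceConst L * (M_T + 2 * B)) * t := by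
    have := mul_nonneg hd0 hAt0; linarith only [this]
  have hdAt : (flatDim L / 2 : ℝ) * (12 * sliceConst L * (M_T + 2 * B) * t) ≤ 1 / 8 := by
    have e : (flatDim L / 2 + 1 : ℝ) * (12 * sliceConst L * (M_T + 2 * B)) * t = (flatDim L / 2 : ℝ) * (12 * sliceConst L * (M_T + 2 * B) * t) + 12 * sliceConst L * (M_T + 2 * B) * t := by
      ring
    linarith only [h13, e, hAt0]
  have hη2 : fpEta L M_T p r ≤ 1 / 2 := by linarith only [hηle, hAr, eA2, h13]
  -- the `s²`-term
  have hs2_0 : 0 ≤ 96 * (Fintype.card (NzSite L) : ℝ) * sliceConst L ^ 2 * δg β ^ 2 := by positivity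
  have hsc : 6 * (Fintype.card (NzSite L) : ℝ) * δg β ^ 2 / (1 / (4 * sliceConst L)) ^ 2 = 96 * Fintype.card (NzSite L) * sliceConst L ^ 2 * δg β ^ 2 := by
    field_simp; ring
  have hη'le : fpEta L M_T p r + 6 * Fintype.card (NzSite L) * δg β ^ 2 / (1 / (4 * sliceConst L)) ^ 2 ≤
      12 * sliceConst L * (M_T + 2 * B) * r + 96 * Fintype.card (NzSite L) * sliceConst L ^ 2 * δg β ^ 2 := by rw [hsc]; linarith only [hηle]
  have hds2 : (flatDim L / 2 : ℝ) * (96 * Fintype.card (NzSite L) * sliceConst L ^ 2 * δg β ^ 2) ≤ 1 / 8 := by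
    have e : (flatDim L / 2 + 1 : ℝ) * (96 * Fintype.card (NzSite L) * sliceConst L ^ 2 * δg β ^ 2) =
        (flatDim L / 2 : ℝ) * (96 * Fintype.card (NzSite L) * sliceConst L ^ 2 * δg β ^ 2) + 96 * Fintype.card (NzSite L) * sliceConst L ^ 2 * δg β ^ 2 := by ring
    linarith only [h17, e, hs2_0]
  have hη'd : (flatDim L / 2 : ℝ) * (fpEta L M_T p r + 6 * Fintype.card (NzSite L) * δg β ^ 2 / (1 / (4 * sliceConst L)) ^ 2) ≤ 1 / 4 := by
    have e1 := mul_le_mul_of_nonneg_left hη'le hd0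
    have e2 : (flatDim L / 2 : ℝ) * (12 * sliceConst L * (M_T + 2 * B) * r) ≤ (flatDim L / 2 : ℝ) * (12 * sliceConst L * (M_T + 2 * B) * t) := mul_le_mul_of_nonneg_left hAr hd0
    have e4 : (flatDim L / 2 : ℝ) * (12 * sliceConst L * (M_T + 2 * B) * r + 96 * Fintype.card (NzSite L) * sliceConst L ^ 2 * δg β ^ 2) =
        (flatDim L / 2 : ℝ) * (12 * sliceConst L * (M_T + 2 * B) * r) + (flatDim L / 2 : ℝ) * (96 * Fintype.card (NzSite L) * sliceConst L ^ 2 * δg β ^ 2) := by ring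
    linarith only [e1, e2, e4, hdAt, hds2]
  have hη'1 : fpEta L M_T p r + 6 * Fintype.card (NzSite L) * δg β ^ 2 / (1 / (4 * sliceConst L)) ^ 2 < 1 := by
    have e3 : 96 * (Fintype.card (NzSite L) : ℝ) * sliceConst L ^ 2 * δg β ^ 2 ≤ 1 / 8 := by
      have e : (flatDim L / 2 + 1 : ℝ) * (96 * Fintype.card (NzSite L) * sliceConst L ^ 2 * δg β ^ 2) =
          (flatDim L / 2 : ℝ) * (96 * Fintype.card (NzSite L) * sliceConst L ^ 2 * δg β ^ 2) + 96 * Fintype.card (NzSite L) * sliceConst L ^ 2 * δg β ^ 2 := by ring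
      have : 0 ≤ (flatDim L / 2 : ℝ) * (96 * Fintype.card (NzSite L) * sliceConst L ^ 2 * δg β ^ 2) := mul_nonneg hd0 hs2_0
      linarith only [h17, e, this]
    linarith only [hη'le, hAr, eA2, h13, e3]
  -- `gramDet` ratio, pointwise in `τ`
  set x : ℝ := K_D * (2 + 32 * K) ^ 2 * τ ^ 2 with hxdef
  have hx : |gramDet L p / gramDet L 0 - 1| ≤ x := by
    refine hpD.trans ?_
    rw [hxdef]
    have h' : ‖p‖ ^ 2 ≤ ((2 + 32 * K) * τ) ^ 2 := pow_le_pow_left₀ (norm_nonneg _) hp 2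
    have h'' := mul_le_mul_of_nonneg_left h' hKD
    have e : K_D * ((2 + 32 * K) * τ) ^ 2 = K_D * (2 + 32 * K) ^ 2 * τ ^ 2 := by ring
    linarith only [h'', e]
  have hττ : τ ^ 2 ≤ t := by nlinarith only [hτ0, hτt, hτ1, ht1]
  have hx2 : x ≤ 1 / 2 := by
    rw [hxdef]
    have := mul_le_mul_of_nonneg_left hττ (by positivity : (0:ℝ) ≤ K_D * (2 + 32 * K) ^ 2); linarith only [this, h16]
  have hx0 : 0 ≤ x := by rw [hxdef]; positivity
  -- STEP 4: the sharp relative bounds at the representative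
  obtain ⟨hlo, hhi⟩ := fpWeight_relative_bounds_sharp L hL hs0 p hpI hMT hεT hT hC hpT hpC hp40 hslice hUfat hr0 hrR hR1half hR1T hcore hsupp hθ hη2 hη'd hη'1 htl hx hx2
  have hbar0 := (fpWeightBar_pos L hs0).le
  rw [hNU]
  constructor
  · refine le_trans (mul_le_mul_of_nonneg_left ?_ hbar0) hlo
    rw [sub_zero, one_mul]
    have hT0 : 0 ≤ (2 : ℝ) ^ (flatDim L / 2 : ℝ) * Real.exp (-((1 / (4 * sliceConst L)) ^ 2 * r ^ 2 / (2 * δg β ^ 2))) := by positivity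
    have hx1 : 0 ≤ 1 - x := by linarith only [hx2]
    have hmono : 1 - (flatDim L / 2 : ℝ) * (12 * sliceConst L * (M_T + 2 * B) * r + 96 * Fintype.card (NzSite L) * sliceConst L ^ 2 * δg β ^ 2) -
        (2 : ℝ) ^ (flatDim L / 2 : ℝ) * Real.exp (-((1 / (4 * sliceConst L)) ^ 2 * r ^ 2 / (2 * δg β ^ 2))) ≤
        1 - (flatDim L / 2 : ℝ) * (fpEta L M_T p r + 6 * Fintype.card (NzSite L) * δg β ^ 2 / (1 / (4 * sliceConst L)) ^ 2) -
        (2 : ℝ) ^ (flatDim L / 2 : ℝ) * Real.exp (-((1 / (4 * sliceConst L)) ^ 2 * r ^ 2 / (2 * δg β ^ 2))) := by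
      have := mul_le_mul_of_nonneg_left hη'le hd0; linarith only [this]
    exact mul_le_mul_of_nonneg_right hmono hx1
  · refine hhi.trans (mul_le_mul_of_nonneg_left ?_ hbar0)
    have hx1 : 0 ≤ 1 + x := by linarith only [hx0]
    have hmono : 1 + 4 * (flatDim L / 2 : ℝ) * fpEta L M_T p r + (4 : ℝ) ^ (flatDim L / 2 : ℝ) * Real.exp (-((1 / (4 * sliceConst L)) ^ 2 * r ^ 2 / (4 * δg β ^ 2))) ≤
        1 + 4 * (flatDim L / 2 : ℝ) * (12 * sliceConst L * (M_T + 2 * B) * r) + (4 : ℝ) ^ (flatDim L / 2 : ℝ) * Real.exp (-((1 / (4 * sliceConst L)) ^ 2 * r ^ 2 / (4 * δg β ^ 2))) := by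
      have := mul_le_mul_of_nonneg_left hηle hd0; linarith only [this]
    exact mul_le_mul_of_nonneg_right hmono hx1

end Summit.QuantumFields.YangMills.Theorems.FemtoTransferGap.TwoLattice.ConstTube

end
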